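import Summits.CriticalPhenomena.SAWScalingLimit.Theorems.SAWRenewalTightnessAnnularMassDecayLastRenewalDecoupling
import Summits.CriticalPhenomena.SAWScalingLimit.Theorems.SAWRenewalTightnessAnnularMassDecayBridgeCodeCount
import Summits.CriticalPhenomena.SAWScalingLimit.Theorems.SAWRenewalTightnessAnnularMassDecayKraftOfCount

/-!
# The last-renewal reduction of `AnnularMassDecay` (stmt-CriticalPhenomena-4729): crux ⇐ S3 ∧ S4, kernel-checked

Line `last-renewal-delocalization` of the crux `Summit.CriticalPhenomena.SAWScalingLimit.Theses.SAWRenewalTightness.AnnularMassDecay`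
(skeleton `Cruxes/AnnularMassDecay/Lines/last_renewal_delocalization.lean`; strategist p1, lead c3).  This file assembles the
landed stubs of the line into two registered sub-goals:

* `lr_lastRenewalStraddle` — the STRADDLING-PIECE INEQUALITY in a real direction `e` (Dyhr–Gilbert–Kennedy–Lawler–Passon's
  "`Q_ℓ` is a (sub)probability measure", arXiv:1008.4321 §2; Kesten 1963): for every unit `e`, start `u`, level `ℓ`, finite
  set of offsets and `N, N'`, `Σ_{x : h(u+x) < ℓ} b_N(u → u+x) · p̄_{N'}(ℓ - h(u+x)) ≤ 1`, from `stub_straddleBlocks` (the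
  straddling family is a block family with the right generating polynomial), `stub_bridgeCodeCount` (block families are uniquely
  decodable codes) and `stub_kraftOfCount` (Kraft at `x_c`);
* `lr_annularMassDecay_of_open_stubs` — the composition: the crux follows from the two OPEN stubs S3
  (`stub_transversalDelocalization`, relative transversal delocalisation of the last renewal point below a level) and S4
  (`stub_irreduciblePrefixOneArm`, span-tail-normalised one-arm bound for a single irreducible excursion), spelled out as
  hypotheses, via S1 `stub_lastRenewalDecoupling`, `lr_lastRenewalStraddle` and the real-analysis lemma `lr_final_bound`.

So the crux is CLOSED MODULO S3 ∧ S4 (both research-level: no technique in print bounds these critical `x_c`-masses on `ℤ²`;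
see the skeleton docstrings for status, plausibility and cheapest falsifiers).  Nothing here asserts S3 or S4.
Sources: B. Dyhr, M. Gilbert, T. Kennedy, G. F. Lawler, S. Passon, J. Stat. Phys. 144 (2011) §2; H. Kesten, J. Math. Phys. 4
(1963) §4; N. Madras, G. Slade, *The Self-Avoiding Walk* (1993) §4.2.
-/

noncomputable section

namespace Summit.CriticalPhenomena.SAWScalingLimit.Theorems.AnnularMassDecay.LastRenewal

open scoped BigOperators Classical ComplexConjugate
open Literature.Probability.LatticeModels Literature.Probability.RandomPlanarGeometry
open Summit.CriticalPhenomena.SAWScalingLimit.Theses.SAWRenewalTightness (AnnularMassDecay)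
open Summit.CriticalPhenomena.SAWScalingLimit.Theorems.AnnularMassDecay.Negative
  (annMass annularMassDecay_iff criticalFugacity_pos)

/-! ## S2: the straddling-piece inequality, assembled -/

/-- **The straddling-piece inequality** (registered sub-goal `lr_lastRenewalStraddle`; DGKLP's "bridges irreducible above
height `ℓ`" carry total `x_c`-weight `≤ 1`, in every REAL direction `e`): for every unit `e ∈ ℂ`, start `u`, level `ℓ`,
finite set `S` of offsets and `N, N'`, `Σ_{x ∈ S, h(u+x) < ℓ} b_N(u → u + x) · p̄_{N'}(ℓ - h(u + x)) ≤ 1`.  Proof: package the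
straddling family as a block family (`stub_straddleBlocks`), decode (`stub_bridgeCodeCount`), Kraft at `x_c`
(`stub_kraftOfCount`), and read the block polynomial at `x = x_c` as `Σ b_N · p̄_{N'}`.
[cite: DyhrGilbertKennedyLawlerPasson2011, §2] -/
theorem lr_lastRenewalStraddle :
    ∀ (e : ℂ), ‖e‖ = 1 → ∀ (u : Site 2) (ℓ : ℝ) (S : Finset (Site 2)) (N N' : ℕ),
      (∑ x ∈ S.filter (fun x => ht e u (u + x) < ℓ), brMass e u x N * irrTail e (ℓ - ht e u (u + x)) N') ≤ 1 := by
  intro e _he u ℓ S N N'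
  obtain ⟨B, hB, hsum⟩ := stub_straddleBlocks e u ℓ S N N'
  have hcount := stub_bridgeCodeCount e ℓ B (N + N') hB
  have hkraft : ∑ b ∈ B, SAW.criticalFugacity ^ b.1 ≤ 1 :=
    stub_kraftOfCount B (N + N') (fun b hb => (hB b hb).2.1) (fun x hx _ K => hcount x hx K)
  have hid := hsum SAW.criticalFugacity
  simp only [brMass, irrTail]
  rw [hid]
  exact hkraft

/-! ## The two-regime real-analysis bound -/

set_option maxHeartbeats 400000 in
/-- Pure real analysis: the two-regime bound behind the composition (`ρ₀ = √(rℓ)`, `θ = min(a,θ₂)/2`; regimes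
`16 r ≤ ℓ ∧ 2 r ≤ R` and its complement, where `r/R ≥ 1/17`). [folklore] -/
theorem lr_final_bound {a θ₂ C₁ C₂ r R D M ℓ : ℝ} (ha : 0 < a) (hθ₂ : 0 < θ₂) (hC₁ : 0 < C₁) (hC₂ : 0 < C₂)
    (hr : 1 ≤ r) (hrR : r < R) (hRD : R ≤ D) (hℓ : ℓ = D - r)
    (h1 : M ≤ C₂)
    (h2 : ∀ ρ₀ : ℝ, 1 ≤ ρ₀ → r < ρ₀ → 2 * ρ₀ ≤ ℓ →
        M ≤ C₂ * ((r / ρ₀) ^ θ₂ + C₁ * (ρ₀ / (ℓ - ρ₀)) ^ a)) :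
    M ≤ (C₂ * (17 : ℝ) ^ (min a θ₂ / 2) + C₂ * (1 + C₁ * (2 : ℝ) ^ a) * (2 : ℝ) ^ (min a θ₂ / 2)) *
      (r / R) ^ (min a θ₂ / 2) := by
  subst hℓ
  set θ : ℝ := min a θ₂ / 2 with hθdef
  set ℓ : ℝ := D - r with hℓdef
  have hθpos : 0 < θ := by
    have : 0 < min a θ₂ := lt_min ha hθ₂
    positivity
  have h2θa : 2 * θ ≤ a := by
    have : min a θ₂ ≤ a := min_le_left _ _
    linarith
  have h2θθ₂ : 2 * θ ≤ θ₂ := by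
    have : min a θ₂ ≤ θ₂ := min_le_right _ _
    linarith
  have hrpos : 0 < r := by linarith
  have hRpos : 0 < R := by linarith
  have hrR0 : 0 ≤ r / R := div_nonneg hrpos.le hRpos.le
  have hrR1 : r / R ≤ 1 := (div_le_one hRpos).2 hrR.le
  have hK₁ : 0 ≤ C₂ * (17 : ℝ) ^ θ := by positivity
  have hK₂ : 0 ≤ C₂ * (1 + C₁ * (2 : ℝ) ^ a) * (2 : ℝ) ^ θ := by positivity
  by_cases hreg : 16 * r ≤ ℓ ∧ 2 * r ≤ R
  · obtain ⟨h16, h2R⟩ := hreg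
    have hℓpos : 0 < ℓ := by linarith
    set ρ₀ : ℝ := Real.sqrt (r * ℓ) with hρ₀def
    have hrℓ0 : 0 ≤ r * ℓ := by positivity
    have hρ₀sq : ρ₀ ^ 2 = r * ℓ := Real.sq_sqrt hrℓ0
    have hρ₀nn : 0 ≤ ρ₀ := Real.sqrt_nonneg _
    have hρ₀ge : 4 * r ≤ ρ₀ := by
      rw [hρ₀def, Real.le_sqrt (by linarith : (0:ℝ) ≤ 4 * r)]
      all_goals nlinarith [hrℓ0, h16, hrpos]
    have hρ₀le : ρ₀ ≤ ℓ / 4 := by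
      rw [hρ₀def]
      calc Real.sqrt (r * ℓ) ≤ Real.sqrt ((ℓ / 4) ^ 2) := Real.sqrt_le_sqrt (by nlinarith)
        _ = ℓ / 4 := Real.sqrt_sq (by positivity)
    have hρ₀pos : 0 < ρ₀ := by linarith
    have hM := h2 ρ₀ (by linarith) (by linarith) (by linarith)
    set y : ℝ := ρ₀ / ℓ with hydef
    have hypos : 0 < y := div_pos hρ₀pos hℓpos
    have hyle : y ≤ 1 / 4 := by
      rw [hydef, div_le_iff₀ hℓpos]; linarith
    have hy1 : y ≤ 1 := by linarith
    have hry : r / ρ₀ = y := by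
      rw [hydef, div_eq_div_iff hρ₀pos.ne' hℓpos.ne']
      nlinarith [hρ₀sq]
    have hysq : y ^ 2 = r / ℓ := by
      rw [hydef, div_pow, hρ₀sq]; field_simp
    have ht : ρ₀ / (ℓ - ρ₀) ≤ 2 * y := by
      have htpos : 0 < ℓ - ρ₀ := by linarith
      rw [div_le_iff₀ htpos, hydef,
        show 2 * (ρ₀ / ℓ) * (ℓ - ρ₀) = ρ₀ * (2 * (ℓ - ρ₀) / ℓ) by ring]
      apply le_mul_of_one_le_right hρ₀nn
      rw [one_le_div hℓpos]
      linarith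
    have ht0 : 0 ≤ ρ₀ / (ℓ - ρ₀) := div_nonneg hρ₀nn (by linarith)
    have hA : (r / ρ₀) ^ θ₂ ≤ y ^ (2 * θ) := by
      rw [hry]
      exact Real.rpow_le_rpow_of_exponent_ge hypos hy1 h2θθ₂
    have hB : (ρ₀ / (ℓ - ρ₀)) ^ a ≤ (2 : ℝ) ^ a * y ^ (2 * θ) := by
      calc (ρ₀ / (ℓ - ρ₀)) ^ a ≤ (2 * y) ^ a := Real.rpow_le_rpow ht0 ht ha.le
        _ ≤ (2 * y) ^ (2 * θ) := Real.rpow_le_rpow_of_exponent_ge (by positivity) (by linarith) h2θa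
        _ = (2 : ℝ) ^ (2 * θ) * y ^ (2 * θ) := Real.mul_rpow (by norm_num) hypos.le
        _ ≤ (2 : ℝ) ^ a * y ^ (2 * θ) := by
          apply mul_le_mul_of_nonneg_right _ (Real.rpow_nonneg hypos.le _)
          exact Real.rpow_le_rpow_of_exponent_le (by norm_num) h2θa
    have hy2θ : y ^ (2 * θ) = (r / ℓ) ^ θ := by
      rw [Real.rpow_mul hypos.le, ← hysq]
      norm_num [Real.rpow_two]
    have hℓR : r / ℓ ≤ 2 * (r / R) := by
      have hRℓ : R / 2 ≤ ℓ := by linarith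
      calc r / ℓ ≤ r / (R / 2) := div_le_div_of_nonneg_left hrpos.le (by positivity) hRℓ
        _ = 2 * (r / R) := by ring
    have hrℓ0' : 0 ≤ r / ℓ := div_nonneg hrpos.le hℓpos.le
    have hC : (r / ℓ) ^ θ ≤ (2 : ℝ) ^ θ * (r / R) ^ θ := by
      calc (r / ℓ) ^ θ ≤ (2 * (r / R)) ^ θ := Real.rpow_le_rpow hrℓ0' hℓR hθpos.le
        _ = (2 : ℝ) ^ θ * (r / R) ^ θ := Real.mul_rpow (by norm_num) hrR0
    have hy2θnn : 0 ≤ y ^ (2 * θ) := Real.rpow_nonneg hypos.le _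
    calc M ≤ C₂ * ((r / ρ₀) ^ θ₂ + C₁ * (ρ₀ / (ℓ - ρ₀)) ^ a) := hM
      _ ≤ C₂ * (y ^ (2 * θ) + C₁ * ((2 : ℝ) ^ a * y ^ (2 * θ))) := by gcongr
      _ = C₂ * (1 + C₁ * (2 : ℝ) ^ a) * (r / ℓ) ^ θ := by rw [hy2θ]; ring
      _ ≤ C₂ * (1 + C₁ * (2 : ℝ) ^ a) * ((2 : ℝ) ^ θ * (r / R) ^ θ) := by gcongr
      _ = C₂ * (1 + C₁ * (2 : ℝ) ^ a) * (2 : ℝ) ^ θ * (r / R) ^ θ := by ring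
      _ ≤ (C₂ * (17 : ℝ) ^ θ + C₂ * (1 + C₁ * (2 : ℝ) ^ a) * (2 : ℝ) ^ θ) * (r / R) ^ θ := by
          have : 0 ≤ (r / R) ^ θ := Real.rpow_nonneg hrR0 _
          nlinarith
  · have hbig : 1 / 17 ≤ r / R := by
      rw [div_le_div_iff₀ (by norm_num) hRpos]
      rcases not_and_or.1 hreg with h | h
      · have h' := not_le.1 h
        have : R ≤ ℓ + r := by rw [hℓdef]; linarith
        linarith
      · have h' := not_le.1 h
        linarith
    have h17 : 1 ≤ (17 : ℝ) ^ θ * (r / R) ^ θ := by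
      rw [← Real.mul_rpow (by norm_num) hrR0]
      apply Real.one_le_rpow _ hθpos.le
      linarith [mul_le_mul_of_nonneg_left hbig (by norm_num : (0 : ℝ) ≤ 17)]
    have : 0 ≤ (r / R) ^ θ := Real.rpow_nonneg hrR0 _
    calc M ≤ C₂ := h1
      _ ≤ C₂ * ((17 : ℝ) ^ θ * (r / R) ^ θ) := le_mul_of_one_le_right hC₂.le h17
      _ ≤ (C₂ * (17 : ℝ) ^ θ + C₂ * (1 + C₁ * (2 : ℝ) ^ a) * (2 : ℝ) ^ θ) * (r / R) ^ θ := by nlinarith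



/-! ## The reduction: `AnnularMassDecay` from the two open one-arm statements -/

/-- **The last-renewal reduction of the crux** (registered sub-goal `lr_annularMassDecay_of_open_stubs`).
`AnnularMassDecay` follows from the two OPEN one-arm statements of the line `last-renewal-delocalization` —
S3 TRANSVERSAL DELOCALISATION of the last renewal point below a level (relative form, height windows at least as thick as
the ball) and S4 the IRREDUCIBLE-PREFIX ONE-ARM bound `N°_N(v) ≤ C₂ · p̄_{N'}(ℓ - h(v)) · (r/|v - z|)^{θ₂}` — using the two
LANDED halves of the cut: S1 `stub_lastRenewalDecoupling` (`annMass ≤ Σ_x b·N°`) and S2 `lr_lastRenewalStraddle`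
(`Σ_x b·p̄ ≤ 1`).  Proof: S4 bounds each `N°`; cut points with `h ≥ ℓ` contribute nothing (`lr_pfxMass_eq_zero_of_le`) and the
others have `|v - z| > r` (`lrd_sub_ht_le_dist`), so `annMass ≤ C₂` by S2 (trivial regime); in the scaling regime split the cut
points at `|v - z| = ρ₀`: far ones pay `(r/ρ₀)^{θ₂}` and sum to `≤ 1` (S2); near ones lie in `B(z, ρ₀)` with
`h ≥ ℓ + r - ρ₀ ≥ ℓ - ρ₀`, so S3 (window `[ℓ - ρ₀, ℓ)`, ball radius `ρ₀`) and S2 bound them by `C₁ (ρ₀/(ℓ - ρ₀))^a`;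
`lr_final_bound` (`ρ₀ = √(rℓ)`, `θ = min(a, θ₂)/2`) concludes.  This is the kernel-checked form of "crux ⇐ S3 ∧ S4".
[cite: DyhrGilbertKennedyLawlerPasson2011, §2] -/
theorem lr_annularMassDecay_of_open_stubs :
    (∃ a C₁ : ℝ, 0 < a ∧ 0 < C₁ ∧ ∀ (e : ℂ), ‖e‖ = 1 → ∀ (u : Site 2) (c : ℂ) (ρ t ℓ : ℝ),
      1 ≤ ρ → ρ ≤ t → t + ρ ≤ ℓ → ∀ (S : Finset (Site 2)) (N N' : ℕ), ∃ N'' N''' : ℕ,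
        (∑ x ∈ S.filter (fun x => dist (Site.toComplex (u + x)) c < ρ ∧ t ≤ ht e u (u + x) ∧ ht e u (u + x) < ℓ),
            brMass e u x N * irrTail e (ℓ - ht e u (u + x)) N') ≤
          C₁ * (ρ / t) ^ a *
            ∑ x ∈ ((box 2 N'').filter (fun x => t ≤ ht e u (u + x))).filter (fun x => ht e u (u + x) < ℓ),
              brMass e u x N'' * irrTail e (ℓ - ht e u (u + x)) N''') →
    (∃ θ₂ C₂ : ℝ, 0 < θ₂ ∧ 0 < C₂ ∧ ∀ (z : ℂ) (r R : ℝ), 1 ≤ r → r < R → ∀ (u : Site 2),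
      R ≤ dist (Site.toComplex u) z → ∀ N : ℕ, ∃ N' : ℕ, ∀ x : Site 2,
        pfxMass z r R u x N ≤ C₂ * irrTail (frameDir z u) (botLevel z r u - ht (frameDir z u) u (u + x)) N' *
          (r / dist (Site.toComplex (u + x)) z) ^ θ₂) →
    Summit.CriticalPhenomena.SAWScalingLimit.Theses.SAWRenewalTightness.AnnularMassDecay := by
  intro h₃ h₄
  have h₁ := stub_lastRenewalDecoupling
  have h₂ := lr_lastRenewalStraddle
  obtain ⟨a, C₁, ha, hC₁, hTD⟩ := h₃
  obtain ⟨θ₂, C₂, hθ₂, hC₂, hIPO⟩ := h₄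
  show AnnularMassDecay
  rw [annularMassDecay_iff]
  refine ⟨min a θ₂ / 2,
    C₂ * (17 : ℝ) ^ (min a θ₂ / 2) + C₂ * (1 + C₁ * (2 : ℝ) ^ a) * (2 : ℝ) ^ (min a θ₂ / 2), ?_, ?_⟩
  · have : 0 < min a θ₂ := lt_min ha hθ₂
    positivity
  intro z r R hr hrR u hRu N
  have hrpos : 0 < r := by linarith
  have hD : 0 < dist (Site.toComplex u) z := by linarith
  set e : ℂ := frameDir z u with hedef
  set ℓ : ℝ := botLevel z r u with hℓdef
  have hℓD : ℓ = dist (Site.toComplex u) z - r := rfl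
  have he : ‖e‖ = 1 := lrd_norm_frameDir hD
  obtain ⟨N', hN'⟩ := hIPO z r R hr hrR u hRu N
  -- geometry on the index set
  have hgeo : ∀ x : Site 2, dist (Site.toComplex u) z - ht e u (u + x) ≤ dist (Site.toComplex (u + x)) z :=
    fun x => lrd_sub_ht_le_dist hD (u + x)
  have hw0 : ∀ x : Site 2, 0 ≤ (r / dist (Site.toComplex (u + x)) z) ^ θ₂ :=
    fun x => Real.rpow_nonneg (div_nonneg hrpos.le dist_nonneg) _
  have hw1 : ∀ x : Site 2, ht e u (u + x) < ℓ → (r / dist (Site.toComplex (u + x)) z) ^ θ₂ ≤ 1 := by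
    intro x hx
    have hd : r < dist (Site.toComplex (u + x)) z := by linarith [hgeo x]
    exact Real.rpow_le_one (div_nonneg hrpos.le dist_nonneg) ((div_le_one (by linarith)).2 hd.le) hθ₂.le
  -- Step 1: decoupling + last-excursion one-arm
  have hmain : annMass z r R u N ≤ C₂ * ∑ x ∈ (box 2 N).filter (fun x => ht e u (u + x) < ℓ),
      brMass e u x N * irrTail e (ℓ - ht e u (u + x)) N' * (r / dist (Site.toComplex (u + x)) z) ^ θ₂ := by
    have hdec := h₁ z r R hr hrR u hRu N
    rw [← Finset.sum_filter_add_sum_filter_not (box 2 N) (fun x => ht e u (u + x) < ℓ)] at hdec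
    have hzero : ∑ x ∈ (box 2 N).filter (fun x => ¬ ht e u (u + x) < ℓ),
        brMass e u x N * pfxMass z r R u x N = 0 := by
      refine Finset.sum_eq_zero fun x hx => ?_
      rw [Finset.mem_filter] at hx
      rw [lr_pfxMass_eq_zero_of_le z r R u x N (not_lt.1 hx.2), mul_zero]
    rw [hzero, add_zero] at hdec
    refine hdec.trans ?_
    rw [Finset.mul_sum]
    refine Finset.sum_le_sum fun x _ => ?_
    calc brMass e u x N * pfxMass z r R u x N
        ≤ brMass e u x N * (C₂ * irrTail e (ℓ - ht e u (u + x)) N' *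
            (r / dist (Site.toComplex (u + x)) z) ^ θ₂) :=
          mul_le_mul_of_nonneg_left (hN' x) (brMass_nonneg e u x N)
      _ = C₂ * (brMass e u x N * irrTail e (ℓ - ht e u (u + x)) N' *
            (r / dist (Site.toComplex (u + x)) z) ^ θ₂) := by ring
  -- Step 2: the trivial regime, `annMass ≤ C₂` (weights ≤ 1, straddling-piece inequality)
  have key1 : annMass z r R u N ≤ C₂ := by
    refine hmain.trans ?_
    have hS := h₂ e he u ℓ (box 2 N) N N'
    calc C₂ * ∑ x ∈ (box 2 N).filter (fun x => ht e u (u + x) < ℓ),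
          brMass e u x N * irrTail e (ℓ - ht e u (u + x)) N' * (r / dist (Site.toComplex (u + x)) z) ^ θ₂
        ≤ C₂ * ∑ x ∈ (box 2 N).filter (fun x => ht e u (u + x) < ℓ),
          brMass e u x N * irrTail e (ℓ - ht e u (u + x)) N' := by
          refine mul_le_mul_of_nonneg_left (Finset.sum_le_sum fun x hx => ?_) hC₂.le
          rw [Finset.mem_filter] at hx
          exact mul_le_of_le_one_right (mul_nonneg (brMass_nonneg e u x N) (irrTail_nonneg e _ N'))
            (hw1 x hx.2)
      _ ≤ C₂ * 1 := mul_le_mul_of_nonneg_left hS hC₂.le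
      _ = C₂ := mul_one _
  -- Step 3: the scaling regime, split at the radius `ρ₀`
  have key2 : ∀ ρ₀ : ℝ, 1 ≤ ρ₀ → r < ρ₀ → 2 * ρ₀ ≤ ℓ →
      annMass z r R u N ≤ C₂ * ((r / ρ₀) ^ θ₂ + C₁ * (ρ₀ / (ℓ - ρ₀)) ^ a) := by
    intro ρ₀ h1ρ hrρ h2ρ
    have hρpos : 0 < ρ₀ := by linarith
    have hρt : ρ₀ ≤ ℓ - ρ₀ := by linarith
    have htℓ : ℓ - ρ₀ + ρ₀ ≤ ℓ := by linarith
    refine hmain.trans (mul_le_mul_of_nonneg_left ?_ hC₂.le)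
    rw [← Finset.sum_filter_add_sum_filter_not ((box 2 N).filter (fun x => ht e u (u + x) < ℓ))
      (fun x => dist (Site.toComplex (u + x)) z < ρ₀)]
    rw [add_comm]
    refine add_le_add ?_ ?_
    · -- FAR part: weight ≤ (r/ρ₀)^θ₂, then the straddling-piece inequality
      have hS := h₂ e he u ℓ (box 2 N) N N'
      calc ∑ x ∈ ((box 2 N).filter (fun x => ht e u (u + x) < ℓ)).filter
              (fun x => ¬ dist (Site.toComplex (u + x)) z < ρ₀),
            brMass e u x N * irrTail e (ℓ - ht e u (u + x)) N' * (r / dist (Site.toComplex (u + x)) z) ^ θ₂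
          ≤ ∑ x ∈ ((box 2 N).filter (fun x => ht e u (u + x) < ℓ)).filter
              (fun x => ¬ dist (Site.toComplex (u + x)) z < ρ₀),
            brMass e u x N * irrTail e (ℓ - ht e u (u + x)) N' * (r / ρ₀) ^ θ₂ := by
            refine Finset.sum_le_sum fun x hx => ?_
            rw [Finset.mem_filter] at hx
            have hdρ : ρ₀ ≤ dist (Site.toComplex (u + x)) z := not_lt.1 hx.2
            refine mul_le_mul_of_nonneg_left ?_
              (mul_nonneg (brMass_nonneg e u x N) (irrTail_nonneg e _ N'))
            exact Real.rpow_le_rpow (div_nonneg hrpos.le dist_nonneg)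
              (div_le_div_of_nonneg_left hrpos.le hρpos hdρ) hθ₂.le
        _ = (r / ρ₀) ^ θ₂ * ∑ x ∈ ((box 2 N).filter (fun x => ht e u (u + x) < ℓ)).filter
              (fun x => ¬ dist (Site.toComplex (u + x)) z < ρ₀),
            brMass e u x N * irrTail e (ℓ - ht e u (u + x)) N' := by
            rw [Finset.mul_sum]
            refine Finset.sum_congr rfl fun x _ => by ring
        _ ≤ (r / ρ₀) ^ θ₂ * ∑ x ∈ (box 2 N).filter (fun x => ht e u (u + x) < ℓ),
            brMass e u x N * irrTail e (ℓ - ht e u (u + x)) N' := by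
            refine mul_le_mul_of_nonneg_left ?_ (Real.rpow_nonneg (div_nonneg hrpos.le hρpos.le) _)
            refine Finset.sum_le_sum_of_subset_of_nonneg (Finset.filter_subset _ _) fun x _ _ => ?_
            exact mul_nonneg (brMass_nonneg e u x N) (irrTail_nonneg e _ N')
        _ ≤ (r / ρ₀) ^ θ₂ * 1 :=
            mul_le_mul_of_nonneg_left hS (Real.rpow_nonneg (div_nonneg hrpos.le hρpos.le) _)
        _ = (r / ρ₀) ^ θ₂ := mul_one _
    · -- NEAR part: weight ≤ 1, enlarge to the delocalisation index set, TD, then straddle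
      obtain ⟨N'', N''', hT⟩ := hTD e he u z ρ₀ (ℓ - ρ₀) ℓ h1ρ hρt htℓ (box 2 N) N N'
      have hS := h₂ e he u ℓ ((box 2 N'').filter (fun x => ℓ - ρ₀ ≤ ht e u (u + x))) N'' N'''
      calc ∑ x ∈ ((box 2 N).filter (fun x => ht e u (u + x) < ℓ)).filter
              (fun x => dist (Site.toComplex (u + x)) z < ρ₀),
            brMass e u x N * irrTail e (ℓ - ht e u (u + x)) N' * (r / dist (Site.toComplex (u + x)) z) ^ θ₂
          ≤ ∑ x ∈ ((box 2 N).filter (fun x => ht e u (u + x) < ℓ)).filter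
              (fun x => dist (Site.toComplex (u + x)) z < ρ₀),
            brMass e u x N * irrTail e (ℓ - ht e u (u + x)) N' := by
            refine Finset.sum_le_sum fun x hx => ?_
            rw [Finset.mem_filter, Finset.mem_filter] at hx
            exact mul_le_of_le_one_right (mul_nonneg (brMass_nonneg e u x N) (irrTail_nonneg e _ N'))
              (hw1 x hx.1.2)
        _ ≤ ∑ x ∈ (box 2 N).filter (fun x => dist (Site.toComplex (u + x)) z < ρ₀ ∧
              ℓ - ρ₀ ≤ ht e u (u + x) ∧ ht e u (u + x) < ℓ),
            brMass e u x N * irrTail e (ℓ - ht e u (u + x)) N' := by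
            refine Finset.sum_le_sum_of_subset_of_nonneg ?_ fun x _ _ =>
              mul_nonneg (brMass_nonneg e u x N) (irrTail_nonneg e _ N')
            intro x hx
            rw [Finset.mem_filter, Finset.mem_filter] at hx
            rw [Finset.mem_filter]
            refine ⟨hx.1.1, hx.2, ?_, hx.1.2⟩
            have := hgeo x
            linarith [hx.2, hr]
        _ ≤ C₁ * (ρ₀ / (ℓ - ρ₀)) ^ a *
            ∑ x ∈ ((box 2 N'').filter (fun x => ℓ - ρ₀ ≤ ht e u (u + x))).filter
              (fun x => ht e u (u + x) < ℓ),
              brMass e u x N'' * irrTail e (ℓ - ht e u (u + x)) N''' := hT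
        _ ≤ C₁ * (ρ₀ / (ℓ - ρ₀)) ^ a * 1 := by
            refine mul_le_mul_of_nonneg_left hS ?_
            exact mul_nonneg hC₁.le (Real.rpow_nonneg (div_nonneg hρpos.le (by linarith)) _)
        _ = C₁ * (ρ₀ / (ℓ - ρ₀)) ^ a := mul_one _
  exact lr_final_bound ha hθ₂ hC₁ hC₂ hr hrR hRu hℓD key1 key2


end Summit.CriticalPhenomena.SAWScalingLimit.Theorems.AnnularMassDecay.LastRenewal

end
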